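import Literature.NumberTheory.EllipticCurves.MultiplicativeUnipotentTorsionProofs
import Literature.NumberTheory.EllipticCurves.GoodReductionUnramifiedProofs
import Literature.NumberTheory.EllipticCurves.TamagawaSubgroupProofs
import Literature.NumberTheory.EllipticCurves.MazurTorsionNodeCountProofs
import Literature.NumberTheory.EllipticCurves.LFunctionPrimeCoeff
import Literature.RingTheory.DiscreteValuationRing.AdicCompletionResidueField
import HarnessLib

/-!
# Mazur 1977, Ch. III §5, Step 4 at the primes `q ≠ N`: `E[N]` is unramified at `q`
# ("`E[N]_{/ℤ_q} ≅ ℤ/N × μ_N`" without the Tate curve)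

Sibling proof file (theorems only, no definitions, no named facts) of
`MazurTorsionLocalStepsProofs`, `MazurTorsionStepOneAtNProofs`, `MazurTorsionStepTwoAtNProofs` and
`MazurTorsionNodeCountProofs`, for the prime-case leaf
`Literature.NumberTheory.EllipticCurves.Mazur1977_no_prime_torsion W` (B. Mazur, *Modular curves
and the Eisenstein ideal*, Publ. Math. IHÉS 47 (1977), Ch. III §5, pp. 156–160).

Mazur's Step 4 (p. 160) shows that `L = ℚ(E[N])` is unramified over `K = ℚ(ζ_N)` for the
putative curve `E/ℚ` with a rational point `P` of prime order `N`: "(i) `q` a rational prime of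
good reduction for `E`; `q ≠ N`: Since `E[N]_{/ℤ_q}` is an étale, finite flat group scheme, `L/K`
is unramified over all places of `K` lying over `q`. … (iii) `q` a rational prime of bad reduction
for `E`: Since `ℤ/N_{/𝔽_q} ⊄ (E_{/𝔽_q})⁰` by step 3, one obtains, as in (ii),
`E[N]_{/ℤ_q} ≅ ℤ/N_{/ℤ_q} × μ_{N/ℤ_q}` giving us the same conclusion: that all places of `K` above
`q` are unramified in `L/K`."  Case (i) is Silverman's Prop. VII.4.1, in the tree as
`WeierstrassCurve.smul_eq_of_mem_inertia_of_nsmul_eq_zero` (`GoodReductionUnramifiedProofs`).  This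
file proves case (iii) at the primes `q ≠ N` — where `K/ℚ` is unramified, so that the printed
conclusion is: *the inertia groups above `q` act trivially on `E[N]`* — without the Tate curve,
and assembles Step 4 at every `q ≠ N` for which the hypothesis of Step 3 is available:

* `WeierstrassCurve.map_eq_of_mem_inertia_of_not_mem_goodReductionSubgroup` — over any number
  field `K` and place `v ∤ p`: for a minimal Weierstrass equation `X/K_v` of an elliptic curve with
  multiplicative reduction and a `K_v`-point `P` with `p P = O` **off** `E₀(K_v)`, every element of
  the inertia group `I_𝔐 ≤ Γ_{K_v}` fixes `X(K̄_v)[p]` pointwise.  Proof: the fixed point `P₁ ∈ E₀`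
  of order `p` of `MultiplicativeUnipotentTorsionProofs` (node map `E₀ ↠ \bar k^×`, kernel `E₁`,
  Hensel; reduction injective on prime-to-`v` torsion of `E₀`; inertia does not move reductions)
  and the rational point `P ∉ E₀` are both fixed, and the fixed subgroup of `X(K̄_v)[p]` (order
  `p²`, `card_torsionPoints_eq_sq_holds`) strictly contains `⟨P₁⟩ ≤ E₀` (order `p`), hence is
  everything.  (Tate-curve dictionary: `E[p] ≅ ⟨ζ_p, q^{1/p}⟩` over `K_v^nr` splits as soon as a
  rational `p`-torsion point lies off the identity component; Silverman, *ATAEC*, V.4–V.5 and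
  Exercise 5.13(b).)
* `WeierstrassCurve.smul_localPoints_eq_of_mem_inertia_of_not_mem_goodReductionSubgroup`,
  `WeierstrassCurve.smul_eq_of_mem_inertia_of_not_mem_goodReductionSubgroup` (global inertia
  groups `I_𝔓 ≤ Γ_K`, by Neukirch II (9.6) as in `GoodReductionUnramifiedProofs`),
  `…smul_geomTorsion_eq…`, `…galoisRepTorsion_eq_one…` — the same for an elliptic curve `E/K`, its
  local minimal model `E.localMinimalModel v` and `E₀ = goodReductionSubgroup 𝓞_v`.
* `prime_dvd_card_sq_sub_one_of_mem_goodReductionSubgroup` — the node count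
  `prime_dvd_sq_sub_one_of_mem_goodReductionSubgroup` of `MazurTorsionNodeCountProofs` over a
  general discrete valuation ring with finite residue field `k`, `char k ≠ 2, 3`: a point of `E₀` of
  prime order `ℓ ∈ k^×` at a multiplicative place forces `ℓ ∣ #k² - 1`.
* `Mazur1977_not_mem_goodReductionSubgroup_of_addOrderOf_eq`, `Mazur1977_not_mem_goodReductionSubgroup_at`
  — for `E/ℚ` with a rational point of prime order `N ∉ {2, 3, 5, 7, 13}` and a bad place `v` with
  `p_v + 1 < N`: the point is off `E₀(ℚ_v)` on `E.localMinimalModel v`, the reduction is split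
  multiplicative and `N ∣ c_v` (Steps 1–2 and the node count at `R = 𝓞_v`; the tree's
  `Mazur1977_not_mem_goodReductionSubgroup_of_lt` in the language of the completions
  `v.adicCompletion ℚ` of the Galois-representation files).
* `Mazur1977_smul_eq_of_mem_inertia`, `Mazur1977_galoisRepTorsion_eq_one_of_mem_inertia` —
  **Step 4 at every place `v` of `ℚ` with `p_v + 1 < N`**: every inertia group above `v` acts
  trivially on `E[N]`, i.e. `ρ̄_{E,N}` is unramified at `v` ((i) at good `v`, (iii) at bad `v`).
* `Mazur1977_smul_eq_of_mem_inertia_of_stepThree` — Step 4 at **every** `v` with `p_v ≠ N`, from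
  the conclusion of Step 3 ("`ℤ/N ⊄ (E_{/𝔽_q})⁰` at every bad `q`") taken as a hypothesis on `E`;
  the printed Step 3 (via `X₀(N)_{/ℤ[1/2N]}` and the Eisenstein quotient) remains necessary exactly
  for the bad primes `q ≥ N - 1`.

Not treated here: the places above `N` (Step 4 (ii), and (iii) for multiplicative reduction at
`N`), where `L/K` is unramified but `K/ℚ` is not.

## References

* [Mazur1977] B. Mazur, *Modular curves and the Eisenstein ideal*, Publ. Math. IHÉS 47 (1977),
  Ch. III §5, Steps 3–4, pp. 159–160.
* [SilvermanAEC2009] J. H. Silverman, *The Arithmetic of Elliptic Curves*, 2nd ed. (2009),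
  VII.2.1, VII.3.1, Prop. VII.4.1, Cor. III.6.4(b), VIII.§1.
* [SilvermanATAEC1994] J. H. Silverman, *Advanced Topics in the Arithmetic of Elliptic Curves*
  (1994), Cor. IV.9.2(d); V.4–V.5 and Exercise 5.13(b) (the Tate-curve form).
* [NeukirchANT1999] J. Neukirch, *Algebraic Number Theory* (1999), Ch. II §9, Prop. (9.6).

## Design

No definitions; `noncomputable section`; `open scoped Classical NNReal Pointwise`; one universe
`u`.  The setting (`K_v = v.adicCompletion K`, `K̄_v`, the spectral valuation `w` with `hw`, the
prime `𝔐` of `\bar 𝓞_v`, `I_𝔐 ≤ Γ_{K_v}`) and step (i) of the main proof are those of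
`MultiplicativeUnipotentTorsionProofs`, followed verbatim; the `𝒪_w`-model is the explicit
`W₀ = X₀.map φ₀` for the codomain restriction `φ₀ : 𝓞_v → 𝒪_w` of `𝓞_v → K_v → K̄_v` (a local
homomorphism), so that `E₀` of `X₀` over `𝓞_v` and of `W₀` over `𝒪_w` can be compared on
`K_v`-points.  `set_option maxHeartbeats` is raised for the main proof, as in the template.
-/

noncomputable section

open scoped Classical NNReal Pointwise
open NumberField IsDedekindDomain

universe u

namespace WeierstrassCurve

open Literature.NumberTheory.EllipticCurves Literature.NumberTheory.GaloisRepresentations Field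
  IsDedekindDomain.HeightOneSpectrum

variable {K : Type u} [Field K] [NumberField K] {v : HeightOneSpectrum (𝓞 K)}

set_option maxHeartbeats 4000000 in
/-- **At a multiplicative place `v ∤ p`, a `K_v`-rational `p`-torsion point off `E₀` makes the
inertia group act trivially on `E[p]`** (model form).  Let `X` be a minimal Weierstrass equation
over `K_v` of an elliptic curve with multiplicative reduction, `p` a prime with `v ∤ p`, and
`P ∈ X(K_v)` a point with `p P = O` which does not lie in `E₀(K_v)`.  Then every element `τ` of
the inertia group `I_𝔐 ≤ Γ_{K_v}` fixes every `Q ∈ X(K̄_v)` with `p Q = O`.  This is Mazur's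
"`E[N]_{/ℤ_q} ≅ ℤ/N × μ_N`" (1977, III.§5, Step 4 (iii), p. 160: "since `ℤ/N_{/𝔽_q} ⊄ (E_{/𝔽_q})⁰`
… one obtains `E[N]_{/ℤ_q} ≅ ℤ/N_{/ℤ_q} × μ_{N/ℤ_q}`, giving … all places of `K` above `q` are
unramified in `L/K`"), proved without the Tate curve: the fixed point `P₁ ∈ E₀` of order `p`
of `MultiplicativeUnipotentTorsionProofs` (node map `E₀ ↠ \bar k^×` and Hensel) and the rational
point `P ∉ E₀` are both fixed by `τ` and generate `X(K̄_v)[p]` (a subgroup of order `p²`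
containing `⟨P₁⟩ ≤ E₀` and `P ∉ E₀`).
[cite: Mazur1977, Ch. III §5, Step 4 (iii), p. 160]
[cite: SilvermanAEC2009, VII.2.1, VII.3.1, Cor. III.6.4(b)]
[cite: SilvermanATAEC1994, V.4–V.5 and Exercise 5.13(b) (the Tate-curve form)] -/
theorem map_eq_of_mem_inertia_of_not_mem_goodReductionSubgroup
    (X : WeierstrassCurve (v.adicCompletion K)) [X.IsElliptic]
    [hmult : X.HasMultiplicativeReduction (v.adicCompletionIntegers K)]
    {p : ℕ} (hp : p.Prime) (hpv : (p : 𝓞 K) ∉ v.asIdeal)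
    {w : Valuation (AlgebraicClosure (v.adicCompletion K)) ℝ≥0}
    (hw : ∀ x, (w x : ℝ) =
      spectralNorm (v.adicCompletion K) (AlgebraicClosure (v.adicCompletion K)) x)
    {𝔐 : Ideal v.localAbsIntegers} (h𝔐 : 𝔐 ∈ v.localPrimesAbove)
    {P : X.toAffine.Point} (hpP : p • P = 0)
    (hP : P ∉ X.goodReductionSubgroup (v.adicCompletionIntegers K))
    {τ : absoluteGaloisGroup (v.adicCompletion K)}
    (hτ : τ ∈ 𝔐.inertia (absoluteGaloisGroup (v.adicCompletion K)))
    (Q : (X.baseChange (AlgebraicClosure (v.adicCompletion K))).toAffine.Point) (hQ : p • Q = 0) :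
    Affine.Point.map ((absoluteGaloisGroup.toAlgEquiv _ τ :
        AlgebraicClosure (v.adicCompletion K) ≃ₐ[v.adicCompletion K]
          AlgebraicClosure (v.adicCompletion K)) :
        AlgebraicClosure (v.adicCompletion K) →ₐ[v.adicCompletion K]
          AlgebraicClosure (v.adicCompletion K)) Q = Q := by
  have hv0 : w.Integers w.integer := Valuation.integer.integers w
  haveI := henselianRing_integer w
  haveI := isAlgClosed_residueField_integer w
  haveI : Fact p.Prime := ⟨hp⟩
  -- write `X = X₀ ⊗ K_v`
  obtain ⟨X₀, rfl⟩ : ∃ X₀ : WeierstrassCurve (v.adicCompletionIntegers K),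
      X = X₀.baseChange (v.adicCompletion K) := IsIntegral.integral
  have hvR := integers_valuationRing_valuation (v.adicCompletionIntegers K) (v.adicCompletion K)
  rw [goodReductionSubgroup_baseChange_eq, mem_nonsingularReductionSubgroup_iff] at hP
  -- multiplicative reduction: `Δ ∈ 𝔪_v`, `c₄ ∉ 𝔪_v`
  have eΔ : (X₀.baseChange (v.adicCompletion K)).Δ =
      algebraMap (v.adicCompletionIntegers K) (v.adicCompletion K) X₀.Δ := map_Δ X₀ _
  have ec : (X₀.baseChange (v.adicCompletion K)).c₄ =
      algebraMap (v.adicCompletionIntegers K) (v.adicCompletion K) X₀.c₄ := map_c₄ X₀ _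
  have hΔm := hmult.badReduction
  have hc₄u := hmult.multiplicativeReduction
  rw [eΔ, IsDedekindDomain.HeightOneSpectrum.valuation_lt_one_iff_mem] at hΔm
  rw [ec, IsDedekindDomain.HeightOneSpectrum.valuation_eq_one_iff_notMem] at hc₄u
  -- the ring homomorphism `𝓞_v → 𝒪_w`
  set f : v.adicCompletionIntegers K →+* AlgebraicClosure (v.adicCompletion K) :=
    (algebraMap (v.adicCompletion K) (AlgebraicClosure (v.adicCompletion K))).comp
      (algebraMap (v.adicCompletionIntegers K) (v.adicCompletion K)) with hfdef
  have hfle : ∀ a, f a ∈ w.integer := fun a ↦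
    (spectralValuation_algebraMap_le_one_iff hw _).mpr a.2
  set φ₀ : v.adicCompletionIntegers K →+* w.integer := f.codRestrict w.integer hfle with hφ₀def
  have hφ₀ : ∀ a, ((φ₀ a : w.integer) : AlgebraicClosure (v.adicCompletion K)) = f a := fun a ↦ rfl
  haveI hφ₀loc : IsLocalHom φ₀ := ⟨fun a ha ↦ by
    by_contra hna
    have hmem : a ∈ IsLocalRing.maximalIdeal (v.adicCompletionIntegers K) :=
      (IsLocalRing.mem_maximalIdeal _).mpr (mem_nonunits_iff.mpr hna)
    have hlt : w (f a) < 1 := spectralValuation_algebraMap_lt_one_of_mem_maximalIdeal hw h𝔐 hmem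
    have h1 : w (f a) = 1 := by
      rw [← hφ₀]; exact (hv0.isUnit_iff_valuation_eq_one).mp ha
    exact absurd h1 hlt.ne⟩
  set W₀ : WeierstrassCurve w.integer := X₀.map φ₀ with hW₀def
  have hX : (X₀.baseChange (v.adicCompletion K)).baseChange (AlgebraicClosure (v.adicCompletion K)) =
      W₀.baseChange (AlgebraicClosure (v.adicCompletion K)) := by
    rw [hW₀def]
    change (X₀.map _).map _ = (X₀.map φ₀).map (algebraMap w.integer _)
    rw [map_map, map_map]
    congr 1
  haveI hint : ((X₀.baseChange (v.adicCompletion K)).baseChange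
      (AlgebraicClosure (v.adicCompletion K))).IsIntegral w.integer := ⟨W₀, hX⟩
  have hκ : W₀.map (IsLocalRing.residue w.integer) =
      ((X₀.map (IsLocalRing.residue (v.adicCompletionIntegers K))).map
        (IsLocalRing.ResidueField.map φ₀)) := by
    rw [hW₀def]
    simp only [map_map]
    congr 1
  -- the reduction of `W₀` is a node
  have hW₀Δ : IsLocalRing.residue w.integer W₀.Δ = 0 := by
    rw [IsLocalRing.residue_eq_zero_iff, hW₀def, map_Δ, IsLocalRing.mem_maximalIdeal,
      mem_nonunits_iff, isUnit_map_iff, ← mem_nonunits_iff, ← IsLocalRing.mem_maximalIdeal]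
    exact hΔm
  have hW₀c₄ : IsLocalRing.residue w.integer W₀.c₄ ≠ 0 := by
    rw [Ne, IsLocalRing.residue_eq_zero_iff, hW₀def, map_c₄, IsLocalRing.mem_maximalIdeal,
      mem_nonunits_iff, isUnit_map_iff, ← mem_nonunits_iff, ← IsLocalRing.mem_maximalIdeal]
    exact hc₄u
  obtain ⟨rn, hrn_surj, hrn⟩ := W₀.exists_addMonoidHom_units_of_node_of_isAlgClosed hv0 hW₀Δ hW₀c₄
  -- valuations of `p`
  have hpw : w ((p : ℤ) : AlgebraicClosure (v.adicCompletion K)) = 1 :=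
    spectralValuation_intCast_eq_one hw (n := (p : ℤ)) (by simpa using hpv)
  have hpw' : w (((p : ℕ) : ℤ) : AlgebraicClosure (v.adicCompletion K)) = 1 := by
    simpa using hpw
  have hpL : ((p : ℕ) : AlgebraicClosure (v.adicCompletion K)) ≠ 0 := by
    intro h0
    have : w ((p : ℤ) : AlgebraicClosure (v.adicCompletion K)) = 0 := by
      rw [Int.cast_natCast, h0, map_zero]
    rw [hpw] at this
    exact one_ne_zero this
  have hpk : ((p : ℕ) : IsLocalRing.ResidueField w.integer) ≠ 0 := by
    have hpw'' : w (algebraMap w.integer (AlgebraicClosure (v.adicCompletion K)) (p : w.integer)) = 1 := by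
      rw [map_natCast]; exact_mod_cast hpw
    have h1 : IsLocalRing.residue w.integer (p : w.integer) ≠ 0 :=
      (v_algebraMap_eq_one_iff hv0 _).mp hpw''
    simpa using h1
  haveI hpnk : NeZero ((p : ℕ) : IsLocalRing.ResidueField w.integer) := ⟨hpk⟩
  /- (i) a point `P₁ ∈ E₀` with `p P₁ = O`, `r(P₁) = b` primitive, fixed by inertia
    (verbatim from `MultiplicativeUnipotentTorsionProofs`) -/
  obtain ⟨b₀, hb₀⟩ := HasEnoughRootsOfUnity.exists_primitiveRoot
    (IsLocalRing.ResidueField w.integer) p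
  have hb₀unit : IsUnit b₀ := hb₀.isUnit hp.ne_zero
  set b : (IsLocalRing.ResidueField w.integer)ˣ := hb₀unit.unit with hbdef
  have hb : IsPrimitiveRoot b p := by
    refine IsPrimitiveRoot.of_map_of_injective (f := Units.coeHom _) ?_ Units.val_injective
    rw [Units.coeHom_apply, hbdef, IsUnit.unit_spec]
    exact hb₀
  have hbpow : p • (Additive.ofMul b) = 0 := by
    rw [← ofMul_pow, hb.pow_eq_one, ofMul_one]
  obtain ⟨P₀, hP₀⟩ := hrn_surj (Additive.ofMul b)
  set S₀ := (Affine.Point.congrEquiv hX).symm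
    (P₀ : (W₀.baseChange (AlgebraicClosure (v.adicCompletion K))).toAffine.Point) with hS₀
  have hcS₀ : Affine.Point.congrEquiv hX S₀ = P₀ := by rw [hS₀, AddEquiv.apply_symm_apply]
  have hS₀E₀ : W₀.HasNonsingularReduction (Affine.Point.congrEquiv hX S₀) := by
    rw [hcS₀]; exact P₀.2
  have hker : W₀.ReducesToZero (Affine.Point.congrEquiv hX (p • S₀)) := by
    have h1 : rn (p • P₀) = 0 := by rw [map_nsmul, hP₀, hbpow]
    have h2 := (hrn _).mp h1
    rwa [AddSubgroup.coe_nsmul, ← hcS₀, ← map_nsmul] at h2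
  obtain ⟨P₁, hP₁E₀, hP₁tors, hP₁img⟩ :
      ∃ P₁ : ((X₀.baseChange (v.adicCompletion K)).baseChange
          (AlgebraicClosure (v.adicCompletion K))).toAffine.Point,
        ∃ hE₀ : W₀.HasNonsingularReduction (Affine.Point.congrEquiv hX P₁),
          p • P₁ = 0 ∧ rn ⟨Affine.Point.congrEquiv hX P₁, hE₀⟩ = Additive.ofMul b := by
    rcases hT : (p • S₀) with _ | ⟨x, y, hxy⟩
    · refine ⟨S₀, hS₀E₀, by rw [hT, Affine.Point.zero_def], ?_⟩
      rw [← hP₀]; congr 1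
    · have hx : 1 < w x := by
        rw [hT, Affine.Point.congrEquiv_some, reducesToZero_some_iff, not_mem_range_iff hv0] at hker
        exact hker
      obtain ⟨x', y', hxy', hx', hdivpt⟩ := exists_zsmul_eq_of_one_lt_val (w := w)
        (V := (X₀.baseChange (v.adicCompletion K)).baseChange
          (AlgebraicClosure (v.adicCompletion K)))
        (m := ((p : ℕ) : ℤ)) hpw' hxy hx
      set Q₁ : ((X₀.baseChange (v.adicCompletion K)).baseChange
          (AlgebraicClosure (v.adicCompletion K))).toAffine.Point := .some x' y' hxy' with hQ₁
      have hQ₁E₁ : W₀.ReducesToZero (Affine.Point.congrEquiv hX Q₁) := by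
        rw [hQ₁, Affine.Point.congrEquiv_some, reducesToZero_some_iff, not_mem_range_iff hv0]
        exact hx'
      have hE₀' : W₀.HasNonsingularReduction (Affine.Point.congrEquiv hX (S₀ - Q₁)) := by
        rw [map_sub]
        exact (W₀.nonsingularReductionSubgroup hv0).sub_mem hS₀E₀ hQ₁E₁.hasNonsingularReduction
      have hdivpt' : ((p : ℕ) : ℤ) • Q₁ = Affine.Point.some x y hxy := by
        rw [hQ₁]; exact hdivpt
      refine ⟨S₀ - Q₁, hE₀', ?_, ?_⟩
      · rw [nsmul_sub, hT, ← natCast_zsmul (Q₁), hdivpt', sub_self]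
      · have hsplit : (⟨Affine.Point.congrEquiv hX (S₀ - Q₁), hE₀'⟩ :
            W₀.nonsingularReductionSubgroup hv0) =
            ⟨Affine.Point.congrEquiv hX S₀, hS₀E₀⟩ -
              ⟨Affine.Point.congrEquiv hX Q₁, hQ₁E₁.hasNonsingularReduction⟩ :=
          Subtype.ext (by
            change Affine.Point.congrEquiv hX (S₀ - Q₁) =
              Affine.Point.congrEquiv hX S₀ - Affine.Point.congrEquiv hX Q₁
            rw [map_sub])
        rw [hsplit, map_sub,
          (hrn ⟨Affine.Point.congrEquiv hX Q₁, hQ₁E₁.hasNonsingularReduction⟩).mpr hQ₁E₁,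
          sub_zero, ← hP₀]
        congr 1
  -- `P₁` is fixed by the inertia group
  have hP₁fix : ∀ σ ∈ 𝔐.inertia (absoluteGaloisGroup (v.adicCompletion K)),
      Affine.Point.map ((absoluteGaloisGroup.toAlgEquiv _ σ :
          AlgebraicClosure (v.adicCompletion K) ≃ₐ[v.adicCompletion K]
            AlgebraicClosure (v.adicCompletion K)) :
          AlgebraicClosure (v.adicCompletion K) →ₐ[v.adicCompletion K]
            AlgebraicClosure (v.adicCompletion K)) P₁ = P₁ := by
    intro σ hσ
    obtain ⟨hσ₁, hσ₂⟩ := isometry_of_mem_inertia hw h𝔐 hσ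
    have hE₀σ := (W₀.hasNonsingularReduction_congrEquiv_map_iff hX
      ((absoluteGaloisGroup.toAlgEquiv _ σ :
          AlgebraicClosure (v.adicCompletion K) ≃ₐ[v.adicCompletion K]
            AlgebraicClosure (v.adicCompletion K)) :
          AlgebraicClosure (v.adicCompletion K) →ₐ[v.adicCompletion K]
            AlgebraicClosure (v.adicCompletion K)) hσ₁ hσ₂ P₁).mpr hP₁E₀
    have hred := W₀.reducePoint_congrEquiv_map_eq hX
      ((absoluteGaloisGroup.toAlgEquiv _ σ :
          AlgebraicClosure (v.adicCompletion K) ≃ₐ[v.adicCompletion K]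
            AlgebraicClosure (v.adicCompletion K)) :
          AlgebraicClosure (v.adicCompletion K) →ₐ[v.adicCompletion K]
            AlgebraicClosure (v.adicCompletion K)) hσ₁ hσ₂ P₁
    have key := W₀.eq_of_reducePoint_eq_of_zsmul_eq_zero hpw' hE₀σ hP₁E₀
      (by rw [← map_zsmul, ← map_zsmul, natCast_zsmul, hP₁tors, map_zero, map_zero])
      (by rw [← map_zsmul, natCast_zsmul, hP₁tors, map_zero]) hred
    exact (Affine.Point.congrEquiv hX).injective key
  -- `P₁ ≠ O` (its node-map image is a primitive `p`-th root of unity)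
  have hP₁ne : P₁ ≠ 0 := by
    intro h0
    have h1 : rn ⟨Affine.Point.congrEquiv hX P₁, hP₁E₀⟩ = 0 := by
      have hz : (⟨Affine.Point.congrEquiv hX P₁, hP₁E₀⟩ :
          W₀.nonsingularReductionSubgroup hv0) = 0 :=
        Subtype.ext (by
          change Affine.Point.congrEquiv hX P₁ = 0
          rw [h0, map_zero])
      rw [hz, map_zero]
    rw [hP₁img, ofMul_eq_zero] at h1
    exact hb.ne_one hp.one_lt h1
  /- (ii) the rational point `P`, read in `X(K̄_v)`: fixed by `Γ_{K_v}`, off `E₀` -/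
  set ι : v.adicCompletion K →ₐ[v.adicCompletion K] AlgebraicClosure (v.adicCompletion K) :=
    Algebra.ofId (v.adicCompletion K) (AlgebraicClosure (v.adicCompletion K)) with hιdef
  set P' : ((X₀.baseChange (v.adicCompletion K)).baseChange
      (AlgebraicClosure (v.adicCompletion K))).toAffine.Point :=
    Affine.Point.map (W' := (X₀.baseChange (v.adicCompletion K)).toAffine)
      (S := v.adicCompletion K) ι P with hP'def
  have hP'fix : ∀ σ : AlgebraicClosure (v.adicCompletion K) →ₐ[v.adicCompletion K]
      AlgebraicClosure (v.adicCompletion K), Affine.Point.map σ P' = P' := by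
    intro σ
    rw [hP'def, Affine.Point.map_map]
    have hσι : σ.comp ι = ι := AlgHom.ext fun x ↦ by
      rw [AlgHom.comp_apply, hιdef, Algebra.ofId_apply, AlgHom.commutes]
    rw [hσι]
  have hpP' : p • P' = 0 := by
    rw [hP'def, ← map_nsmul]
    exact (congrArg (Affine.Point.map (W' := (X₀.baseChange (v.adicCompletion K)).toAffine)
      (S := v.adicCompletion K) ι) hpP).trans (map_zero _)
  have hP'E₀ : ¬ W₀.HasNonsingularReduction (Affine.Point.congrEquiv hX P') := by
    intro hns
    apply hP
    rcases point_cases hvR P with rfl | ⟨x, y, h, rfl, hx⟩ | ⟨a, c, h, rfl⟩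
    · exact hasNonsingularReduction_zero
    · exact Or.inl ((not_mem_range_iff hvR).mpr hx)
    · rw [hasNonsingularReduction_some_algebraMap_iff hvR.hom_inj h]
      have h' : ((X₀.baseChange (v.adicCompletion K)).baseChange
          (v.adicCompletion K)).toAffine.Nonsingular
          (algebraMap (v.adicCompletionIntegers K) (v.adicCompletion K) a)
          (algebraMap (v.adicCompletionIntegers K) (v.adicCompletion K) c) := h
      have hmap : P' = Affine.Point.map (W' := (X₀.baseChange (v.adicCompletion K)).toAffine)
          (S := v.adicCompletion K) ι (.some _ _ h') := rfl
      rw [hmap, Affine.Point.map_some, Affine.Point.congrEquiv_some] at hns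
      have hns' := (hasNonsingularReduction_some_algebraMap_iff hv0.hom_inj
        (a := φ₀ a) (b := φ₀ c) _).mp hns
      rw [hκ, ← IsLocalRing.ResidueField.map_residue, ← IsLocalRing.ResidueField.map_residue] at hns'
      exact (Affine.map_nonsingular _ (IsLocalRing.ResidueField.map φ₀).injective _ _).mp hns'
  /- (iii) counting in `X(K̄_v)[p]`, of order `p²` -/
  set G := torsionPoints (X₀.baseChange (v.adicCompletion K))
    (AlgebraicClosure (v.adicCompletion K)) p with hGdef
  have hcardG : Nat.card G = p ^ 2 :=
    card_torsionPoints_eq_sq_holds (X₀.baseChange (v.adicCompletion K))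
      (AlgebraicClosure (v.adicCompletion K)) hpL
  set τ' : AlgebraicClosure (v.adicCompletion K) →ₐ[v.adicCompletion K]
      AlgebraicClosure (v.adicCompletion K) :=
    ((absoluteGaloisGroup.toAlgEquiv _ τ :
        AlgebraicClosure (v.adicCompletion K) ≃ₐ[v.adicCompletion K]
          AlgebraicClosure (v.adicCompletion K)) :
        AlgebraicClosure (v.adicCompletion K) →ₐ[v.adicCompletion K]
          AlgebraicClosure (v.adicCompletion K)) with hτ'def
  set Fix : AddSubgroup ((X₀.baseChange (v.adicCompletion K)).baseChange
      (AlgebraicClosure (v.adicCompletion K))).toAffine.Point :=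
    (Affine.Point.map (W' := (X₀.baseChange (v.adicCompletion K)).toAffine) τ' -
      AddMonoidHom.id _).ker with hFixdef
  have hmemFix : ∀ R, R ∈ Fix ↔ Affine.Point.map τ' R = R := fun R ↦ by
    rw [hFixdef, AddMonoidHom.mem_ker, AddMonoidHom.sub_apply, AddMonoidHom.id_apply, sub_eq_zero]
  set H : AddSubgroup _ := Fix ⊓ G with hHdef
  set E₀ : AddSubgroup ((X₀.baseChange (v.adicCompletion K)).baseChange
      (AlgebraicClosure (v.adicCompletion K))).toAffine.Point :=
    (W₀.nonsingularReductionSubgroup hv0).comap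
      (Affine.Point.congrEquiv hX).toAddMonoidHom with hE₀def
  have hmemE₀ : ∀ R, R ∈ E₀ ↔ W₀.HasNonsingularReduction (Affine.Point.congrEquiv hX R) :=
    fun R ↦ Iff.rfl
  have hmemG : ∀ R : ((X₀.baseChange (v.adicCompletion K)).baseChange
      (AlgebraicClosure (v.adicCompletion K))).toAffine.Point, R ∈ G ↔ p • R = 0 := fun R ↦ by
    rw [hGdef, mem_torsionPoints_iff, natCast_zsmul]
  have hP₁H : P₁ ∈ H := ⟨(hmemFix _).mpr (hP₁fix τ hτ), (hmemG _).mpr hP₁tors⟩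
  have hzH : AddSubgroup.zmultiples P₁ ≤ H := (AddSubgroup.zmultiples_le_of_mem hP₁H)
  have hzE₀ : AddSubgroup.zmultiples P₁ ≤ E₀ :=
    AddSubgroup.zmultiples_le_of_mem ((hmemE₀ _).mpr hP₁E₀)
  have hP'H : P' ∈ H := ⟨(hmemFix _).mpr (hP'fix τ'), (hmemG _).mpr hpP'⟩
  have hP'z : P' ∉ AddSubgroup.zmultiples P₁ := fun h ↦ hP'E₀ ((hmemE₀ _).mp (hzE₀ h))
  have hHle : H ≤ G := inf_le_right
  haveI hGfin : Finite G := Nat.finite_of_card_ne_zero (by rw [hcardG]; exact pow_ne_zero _ hp.ne_zero)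
  haveI hHfin : Finite H := Finite.of_injective _ (AddSubgroup.inclusion_injective hHle)
  have hcardz : Nat.card (AddSubgroup.zmultiples P₁) = p := by
    rw [Nat.card_zmultiples, addOrderOf_eq_prime hP₁tors hP₁ne]
  have hHdvd : Nat.card H ∣ p ^ 2 := hcardG ▸ AddSubgroup.card_dvd_of_le hHle
  obtain ⟨i, hi, hcardH⟩ := (Nat.dvd_prime_pow hp).mp hHdvd
  have hHG : H = G := by
    have hi2 : i = 2 := by
      by_contra hne
      have hle : Nat.card H ≤ Nat.card (AddSubgroup.zmultiples P₁) := by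
        rw [hcardH, hcardz]
        calc p ^ i ≤ p ^ 1 := Nat.pow_le_pow_right hp.pos (by omega)
          _ = p := pow_one p
      have heq := AddSubgroup.eq_of_le_of_card_ge hzH hle
      exact hP'z (heq ▸ hP'H)
    refine AddSubgroup.eq_of_le_of_card_ge hHle ?_
    rw [hcardH, hi2, hcardG]
  have hQG : Q ∈ G := (hmemG _).mpr hQ
  rw [← hHG] at hQG
  exact (hmemFix _).mp hQG.1

/-- **The same for an elliptic curve `E/K` and its local points `E(K̄_v)`.**  Let `E/K` be an
elliptic curve over a number field with multiplicative reduction at `v`, `p` a prime with `v ∤ p`,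
and suppose the minimal model `X = E.localMinimalModel v` has a `K_v`-rational point `P` with
`p P = O` outside `E₀(K_v) = X.goodReductionSubgroup 𝓞_v` (for a `K`-rational point of order `p`
this is Mazur's "`ℤ/N_{/𝔽_q} ⊄ (E_{/𝔽_q})⁰`", 1977, III.§5, Step 3).  Then the inertia group
`I_𝔐 ≤ Γ_{K_v}` acts trivially on `E(K̄_v)[p]` — "`E[N]_{/ℤ_q} ≅ ℤ/N × μ_N`", Step 4 (iii) —
by transport of `map_eq_of_mem_inertia_of_not_mem_goodReductionSubgroup` along the equivariant
`E(K̄_v) ≃ X(K̄_v)` (`exists_addEquiv_localPoints_of_smul_eq`).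
[cite: Mazur1977, Ch. III §5, Step 4 (iii), p. 160]
[cite: SilvermanATAEC1994, V.4–V.5 and Exercise 5.13(b) (the Tate-curve form)] -/
theorem smul_localPoints_eq_of_mem_inertia_of_not_mem_goodReductionSubgroup
    (W : WeierstrassCurve K) [W.IsElliptic]
    (hmult : W.HasMultiplicativeReductionAt v) {p : ℕ} (hp : p.Prime) (hpv : (p : 𝓞 K) ∉ v.asIdeal)
    {w : Valuation (AlgebraicClosure (v.adicCompletion K)) ℝ≥0}
    (hw : ∀ x, (w x : ℝ) =
      spectralNorm (v.adicCompletion K) (AlgebraicClosure (v.adicCompletion K)) x)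
    {𝔐 : Ideal v.localAbsIntegers} (h𝔐 : 𝔐 ∈ v.localPrimesAbove)
    {P : (W.localMinimalModel v).toAffine.Point} (hpP : p • P = 0)
    (hP : P ∉ (W.localMinimalModel v).goodReductionSubgroup (v.adicCompletionIntegers K))
    {τ : absoluteGaloisGroup (v.adicCompletion K)}
    (hτ : τ ∈ 𝔐.inertia (absoluteGaloisGroup (v.adicCompletion K)))
    (Q : localPoints W (v.adicCompletion K)) (hQ : p • Q = 0) : τ • Q = Q := by
  haveI : (W.localMinimalModel v).IsElliptic := W.isElliptic_localMinimalModel v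
  haveI : (W.localMinimalModel v).HasMultiplicativeReduction (v.adicCompletionIntegers K) := hmult
  obtain ⟨C, hC⟩ := W.exists_variableChange_smul_eq_localMinimalModel v
  obtain ⟨Φ, hΦ⟩ := W.exists_addEquiv_localPoints_of_smul_eq v hC
  have key := (W.localMinimalModel v).map_eq_of_mem_inertia_of_not_mem_goodReductionSubgroup
    hp hpv hw h𝔐 hpP hP hτ (Φ Q) (by rw [← map_nsmul, hQ, map_zero])
  apply Φ.injective
  rw [hΦ]
  exact key

/-- **Global form: the inertia groups of `Γ_K` above `v` act trivially on `E[p]`.**  For an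
elliptic curve `E/K` over a number field, a place `v ∤ p` of multiplicative reduction at which the
minimal model has a `K_v`-rational `p`-torsion point off `E₀(K_v)`, a prime `𝔓` of `\bar ℤ_K`
above `v` and `τ` in the inertia group `I_𝔓 ≤ Gal(K̄/K)`: every `Q ∈ E(K̄)` with `p Q = O` is
fixed by `τ`, i.e. `E[p]` is unramified at `v` — Mazur 1977, III.§5, Step 4 (iii): "all places
of `K` above `q` are unramified in `L/K`" (`L = ℚ(E[N])`; over `K = ℚ(ζ_N)` as well, `K/ℚ` being
unramified at `q ≠ N`).  From the local form by lifting `τ` to the local inertia group along an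
embedding `K̄ → K̄_v` cutting out `𝔓` (Neukirch II (9.6), `exists_mem_inertia_apply_eq_holds`),
as in `smul_geomPoints_eq_of_mem_inertia` (`GoodReductionUnramifiedProofs`).
[cite: Mazur1977, Ch. III §5, Step 4 (iii), p. 160] [cite: NeukirchANT1999, Ch. II §9 Prop. (9.6)] -/
theorem smul_eq_of_mem_inertia_of_not_mem_goodReductionSubgroup
    (W : WeierstrassCurve K) [W.IsElliptic]
    (hmult : W.HasMultiplicativeReductionAt v) {p : ℕ} (hp : p.Prime) (hpv : (p : 𝓞 K) ∉ v.asIdeal)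
    {P : (W.localMinimalModel v).toAffine.Point} (hpP : p • P = 0)
    (hP : P ∉ (W.localMinimalModel v).goodReductionSubgroup (v.adicCompletionIntegers K))
    {𝔓 : Ideal (absIntegers (𝓞 K) K)} (h𝔓 : 𝔓 ∈ v.primesAbove)
    {τ : absoluteGaloisGroup K} (hτ : τ ∈ 𝔓.inertia (absoluteGaloisGroup K))
    {Q : geomPoints W} (hQ : p • Q = 0) : τ • Q = Q := by
  obtain ⟨w, hw⟩ := v.exists_spectralValuation
  obtain ⟨𝔐, h𝔐⟩ := v.localPrimesAbove_nonempty
  -- arrange `𝔓 = 𝔓_{ι,𝔐}` for an embedding `ι : K̄ → K̄_v` (transitivity of `Γ_K` on `primesAbove`)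
  obtain ⟨g, hg⟩ := HeightOneSpectrum.exists_smul_eq_of_mem_primesAbove_holds
    (HeightOneSpectrum.primeBelow_mem_primesAbove
      (ι := closureEmb (K := K) (v.adicCompletion K)) h𝔐) h𝔓
  set ι : AlgebraicClosure K →ₐ[K] AlgebraicClosure (v.adicCompletion K) :=
    (closureEmb (K := K) (v.adicCompletion K)).comp
      ((show AlgebraicClosure K ≃ₐ[K] AlgebraicClosure K from g⁻¹) :
        AlgebraicClosure K →ₐ[K] AlgebraicClosure K) with hι
  have h1 : 𝔓 = v.primeBelow ι 𝔐 := by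
    rw [hι, HeightOneSpectrum.primeBelow_comp, ← hg]
    exact congrArg (· • _) (inv_inv g).symm
  rw [h1] at hτ
  -- lift `τ ∈ I_𝔓` to the local inertia group `I_𝔐 ≤ Γ_{K_v}` (Neukirch II (9.6))
  obtain ⟨σ, hσI, hσ⟩ :=
    IsDedekindDomain.HeightOneSpectrum.exists_mem_inertia_apply_eq_holds v ι h𝔐 hτ
  have hres : resGalOfEmb ι σ = τ := resGalOfEmb_eq_of_apply_eq ι hσ
  have hequiv : pointsMapOfEmb W ι (τ • Q) = σ • pointsMapOfEmb W ι Q := by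
    rw [← hres]
    exact pointsMapOfEmb_smul W ι σ Q
  have hfix : σ • pointsMapOfEmb W ι Q = pointsMapOfEmb W ι Q :=
    W.smul_localPoints_eq_of_mem_inertia_of_not_mem_goodReductionSubgroup hmult hp hpv hw h𝔐
      hpP hP hσI _ (by rw [← map_nsmul, hQ, map_zero])
  exact pointsMapOfEmb_injective W ι (hequiv.trans hfix)

/-- The same on the `Γ_K`-module `E[p] = geomTorsion W p`. [cite: Mazur1977, Ch. III §5, Step 4 (iii), p. 160] -/
theorem smul_geomTorsion_eq_of_mem_inertia_of_not_mem_goodReductionSubgroup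
    (W : WeierstrassCurve K) [W.IsElliptic]
    (hmult : W.HasMultiplicativeReductionAt v) {p : ℕ} (hp : p.Prime) (hpv : (p : 𝓞 K) ∉ v.asIdeal)
    {P : (W.localMinimalModel v).toAffine.Point} (hpP : p • P = 0)
    (hP : P ∉ (W.localMinimalModel v).goodReductionSubgroup (v.adicCompletionIntegers K))
    {𝔓 : Ideal (absIntegers (𝓞 K) K)} (h𝔓 : 𝔓 ∈ v.primesAbove)
    {τ : absoluteGaloisGroup K} (hτ : τ ∈ 𝔓.inertia (absoluteGaloisGroup K))
    (Q : geomTorsion W (p : ℤ)) : τ • Q = Q :=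
  Subtype.ext <| by
    rw [AddSubgroup.torsionBy.coe_smul]
    exact W.smul_eq_of_mem_inertia_of_not_mem_goodReductionSubgroup hmult hp hpv hpP hP h𝔓 hτ
      (by
        have h := (Submodule.mem_torsionBy_iff (p : ℤ) Q.1).mp Q.2
        rwa [natCast_zsmul] at h)

/-- **Representation form: `ρ̄_{E,p}(τ) = 1` for `τ` in an inertia group above `v`** — the mod-`p`
representation `ρ̄_{E,p} : Γ_K → Aut(E[p])` (`galoisRepTorsion`) is unramified at a multiplicative
place `v ∤ p` whose minimal model carries a rational `p`-torsion point off `E₀(K_v)`.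
[cite: Mazur1977, Ch. III §5, Step 4 (iii), p. 160] -/
theorem galoisRepTorsion_eq_one_of_mem_inertia_of_not_mem_goodReductionSubgroup
    (W : WeierstrassCurve K) [W.IsElliptic]
    (hmult : W.HasMultiplicativeReductionAt v) {p : ℕ} (hp : p.Prime) (hpv : (p : 𝓞 K) ∉ v.asIdeal)
    {P : (W.localMinimalModel v).toAffine.Point} (hpP : p • P = 0)
    (hP : P ∉ (W.localMinimalModel v).goodReductionSubgroup (v.adicCompletionIntegers K))
    {𝔓 : Ideal (absIntegers (𝓞 K) K)} (h𝔓 : 𝔓 ∈ v.primesAbove)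
    {τ : absoluteGaloisGroup K} (hτ : τ ∈ 𝔓.inertia (absoluteGaloisGroup K)) :
    galoisRepTorsion W (p : ℤ) τ = 1 := by
  refine Multiplicative.toAdd.injective (AddEquiv.ext fun Q ↦ ?_)
  rw [galoisRepTorsion_apply]
  exact W.smul_geomTorsion_eq_of_mem_inertia_of_not_mem_goodReductionSubgroup hmult hp hpv hpP hP
    h𝔓 hτ Q

end WeierstrassCurve

namespace Literature.NumberTheory.EllipticCurves

open _root_.WeierstrassCurve IsDedekindDomain IsDedekindDomain.HeightOneSpectrum NumberField Field
  Literature.NumberTheory.GaloisRepresentations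

/-! ## A point of `E₀` of prime order `ℓ` at a multiplicative place gives `ℓ ∣ #k² - 1` -/

section DVR

variable (R : Type*) [CommRing R] [IsDomain R] [IsDiscreteValuationRing R] {K : Type*}
  [Field K] [Algebra R K] [IsFractionRing R K]

/-- **Multiplicative reduction over a discrete valuation ring with finite residue field `k` of
characteristic `≠ 2, 3`: a point of `E₀(K)` of prime order `ℓ`, `ℓ` non-zero in `k`, forces
`ℓ ∣ #k² - 1`** (Mazur 1977, p. 159, second sentence of Step 2: "`(E_{/𝔽_q})⁰` is isomorphic to
`𝔾_{m/𝔽_q}`, which has `q² - 1` points" over `𝔽_{q²}`): `⟨P⟩ ↪ Ẽ_ns(k)` (Silverman, *AEC*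
VII.2.1/VII.3.1: the kernel `E₁` has no `ℓ`-torsion) and `#Ẽ_ns(k) ∣ #k² - 1` at a node
(`natCard_point_dvd_sq_sub_one_of_node`).  This is
`prime_dvd_sq_sub_one_of_mem_goodReductionSubgroup` of `MazurTorsionNodeCountProofs` (there over
`ℤ_q`) over a general discrete valuation ring, for use at the completions `𝓞_{ℚ,v}`.
[cite: Mazur1977, Ch. III §5, Step 2, p. 159; SilvermanAEC2009, VII.2 Prop. 2.1, VII.3 Prop. 3.1(b), VII.5 Prop. 5.1(b)] -/
theorem prime_dvd_card_sq_sub_one_of_mem_goodReductionSubgroup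
    [Finite (IsLocalRing.ResidueField R)] (h2 : ringChar (IsLocalRing.ResidueField R) ≠ 2)
    (h3 : ringChar (IsLocalRing.ResidueField R) ≠ 3) {ℓ : ℕ} (hℓ : ℓ.Prime)
    (hℓk : (ℓ : IsLocalRing.ResidueField R) ≠ 0) (V : WeierstrassCurve K) [V.IsElliptic]
    [hm : V.HasMultiplicativeReduction R] {P : V.toAffine.Point} (hP0 : P ≠ 0)
    (hℓP : (ℓ : ℤ) • P = 0) (hP : P ∈ V.goodReductionSubgroup R) :
    ℓ ∣ Nat.card (IsLocalRing.ResidueField R) ^ 2 - 1 := by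
  have hΔ := hm.badReduction
  have hc₄ := hm.multiplicativeReduction
  obtain ⟨W₀, rfl⟩ : ∃ W₀ : WeierstrassCurve R, V = W₀.baseChange K := IsIntegral.integral
  have eΔ : (W₀.baseChange K).Δ = algebraMap R K W₀.Δ := map_Δ W₀ (algebraMap R K)
  have ec : (W₀.baseChange K).c₄ = algebraMap R K W₀.c₄ := map_c₄ W₀ (algebraMap R K)
  rw [eΔ, IsDedekindDomain.HeightOneSpectrum.valuation_lt_one_iff_mem] at hΔ
  rw [ec, IsDedekindDomain.HeightOneSpectrum.valuation_eq_one_iff_notMem] at hc₄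
  have hΔ' : (W₀.map (IsLocalRing.residue R)).Δ = 0 := by
    rw [map_Δ]; exact (IsLocalRing.residue_eq_zero_iff _).mpr hΔ
  have hc₄' : (W₀.map (IsLocalRing.residue R)).c₄ ≠ 0 := by
    rw [map_c₄]; exact fun h => hc₄ ((IsLocalRing.residue_eq_zero_iff _).mp h)
  have hv := integers_valuationRing_valuation R K
  rw [goodReductionSubgroup_baseChange_eq, mem_nonsingularReductionSubgroup_iff] at hP
  haveI := Fintype.ofFinite (IsLocalRing.ResidueField R)
  haveI : Finite (W₀.map (IsLocalRing.residue R)).toAffine.Point := finite_point _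
  -- `⟨P⟩ ↪ Ẽ_ns(k)`
  have hℓv : ValuationRing.valuation R K ((ℓ : ℤ) : K) = 1 := by
    rw [show ((ℓ : ℤ) : K) = algebraMap R K (ℓ : R) by simp, v_algebraMap_eq_one_iff hv]
    simpa using hℓk
  have hle : AddSubgroup.zmultiples P ≤ W₀.nonsingularReductionSubgroup hv :=
    AddSubgroup.zmultiples_le_of_mem hP
  set f : AddSubgroup.zmultiples P →+ (W₀.map (IsLocalRing.residue R)).toAffine.Point :=
    (W₀.reductionHom hv).comp (AddSubgroup.inclusion hle) with hf_def
  have hf : Function.Injective f := by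
    rw [injective_iff_map_eq_zero]
    rintro ⟨Q, hQ⟩ hfQ
    obtain ⟨m, rfl⟩ := AddSubgroup.mem_zmultiples_iff.mp hQ
    have hred : W₀.reducePoint (m • P) = 0 := hfQ
    have h0 : W₀.ReducesToZero (m • P) :=
      (_root_.WeierstrassCurve.reducePoint_eq_zero_iff hv (hle hQ)).mp hred
    have hp' : (ℓ : ℤ) • (m • P) = 0 := by
      rw [← mul_zsmul, mul_comm, mul_zsmul, hℓP, zsmul_zero]
    by_contra hne
    exact not_reducesToZero_of_zsmul_eq_zero hv hℓv hp' (fun h => hne (Subtype.ext h)) h0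
  haveI : Fact ℓ.Prime := ⟨hℓ⟩
  have hord : addOrderOf P = ℓ := by
    refine addOrderOf_eq_prime ?_ hP0
    rw [← natCast_zsmul]; exact hℓP
  have h1 : ℓ ∣ Nat.card (W₀.map (IsLocalRing.residue R)).toAffine.Point := by
    calc ℓ = Nat.card (AddSubgroup.zmultiples P) := by rw [Nat.card_zmultiples, hord]
      _ ∣ _ := AddSubgroup.card_dvd_of_injective f hf
  -- `#Ẽ_ns(k) ∣ #k² - 1`
  have hnode := (W₀.map (IsLocalRing.residue R)).natCard_point_dvd_sq_sub_one_of_node h2 h3 hΔ' hc₄'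
  rw [← Nat.card_eq_fintype_card] at hnode
  exact h1.trans hnode

end DVR

/-! ## Over `ℚ`: Mazur's Step 4 (iii) at every prime `q ≠ N` with `q + 1 < N` -/

section Rat

open Rat.HeightOneSpectrum

variable (W : WeierstrassCurve ℚ) [W.IsElliptic]

/-- A natural number lies in the finite place `v` of `ℚ` iff the prime under `v` divides it
(private copy of the tree's `natCast_mem_asIdeal_iff`, `ComplexMultiplicationDeuringFrobeniusProofs`,
to keep the imports of this file small). [folklore] -/
private theorem natCast_mem_asIdeal_iff' (v : HeightOneSpectrum (𝓞 ℚ)) (n : ℕ) :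
    (n : 𝓞 ℚ) ∈ v.asIdeal ↔ (primesEquiv v : ℕ) ∣ n := by
  change _ ↔ natGenerator v ∣ n
  rw [natGenerator_dvd_iff, Ideal.mem_map_of_equiv]
  constructor
  · intro h
    exact ⟨n, h, map_natCast _ n⟩
  · rintro ⟨x, hx, hxn⟩
    have : x = n := (Rat.IsIntegralClosure.intEquiv (𝓞 ℚ)).injective (by rw [hxn, map_natCast])
    rwa [this] at hx

/-- The residue field of `𝓞_{ℚ,v}` has characteristic `p_v`, the prime under `v`. [folklore] -/
private theorem ringChar_residueField_adicCompletionIntegers (v : HeightOneSpectrum (𝓞 ℚ)) :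
    ringChar (IsLocalRing.ResidueField (v.adicCompletionIntegers ℚ)) = (primesEquiv v : ℕ) := by
  have hv : ((primesEquiv v : ℕ) : 𝓞 ℚ) ∈ v.asIdeal := (natCast_mem_asIdeal_iff' v _).mpr dvd_rfl
  have h0 : ((primesEquiv v : ℕ) : IsLocalRing.ResidueField (v.adicCompletionIntegers ℚ)) = 0 := by
    have h := (HeightOneSpectrum.residue_algebraMap_eq_zero_iff ℚ v ((primesEquiv v : ℕ) : 𝓞 ℚ)).mpr hv
    simpa only [map_natCast] using h
  exact CharP.ringChar_of_prime_eq_zero (primesEquiv v).2 h0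

/-- **Mazur's "`ℤ/N ⊄ (E_{/𝔽_q})⁰`" at a bad place `v` of `ℚ` with `p_v + 1 < N`, for a point of
order `N` of the minimal model over `ℚ_v = v.adicCompletion ℚ`.**  Let `E/ℚ` be an elliptic curve,
`v` a place of bad reduction whose prime `q = p_v` satisfies `q + 1 < N` for a prime
`N ∉ {2, 3, 5, 7, 13}`, and `P'` a `ℚ_v`-point of order `N` of `E.localMinimalModel v`.  Then `P'`
lies outside `E₀(ℚ_v)`, the reduction at `v` is split multiplicative, and
`N ∣ c_v = [E(ℚ_v) : E₀(ℚ_v)]`.  Proof, from the tree's discrete-valuation-ring lemmas at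
`R = 𝓞_v`: the reduction is not additive (`eq_zero_of_hasAdditiveReduction_of_prime_nsmul_eq_zero`,
Mazur's Step 1 at `q ≠ N`); were `P'` in `E₀(ℚ_v)`, then `N ≤ 2q + 1`
(`addOrderOf_le_of_mem_goodReductionSubgroup`, Step 2) and, for `q ≥ 5`, `N ∣ q² - 1`
(`prime_dvd_card_sq_sub_one_of_mem_goodReductionSubgroup`), i.e. `N ≤ q + 1`; off `E₀` the
Kodaira–Néron index argument (`hasSplitMultiplicativeReduction_of_not_mem_goodReductionSubgroup`)
gives the rest.  (The printed Step 3, p. 159, proves "`ℤ/N ⊄ (E_{/𝔽_q})⁰`" at **every** bad `q` via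
`X₀(N)_{/ℤ[1/2N]}` and the Eisenstein quotient; that argument remains necessary only for bad primes
`q ≥ N - 1`.)
[cite: Mazur1977, Ch. III §5, Steps 1–3, pp. 158–160; SilvermanATAEC1994, Cor. IV.9.2(d) (PDF p. 340)] -/
theorem Mazur1977_not_mem_goodReductionSubgroup_of_addOrderOf_eq {N : ℕ} (hN : N.Prime)
    (hNS : N ∉ ({2, 3, 5, 7, 13} : Finset ℕ)) (v : HeightOneSpectrum (𝓞 ℚ))
    (hq : (primesEquiv v : ℕ) + 1 < N) (hbad : ¬ W.HasGoodReductionAt v)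
    {P' : (W.localMinimalModel v).toAffine.Point} (hP'ord : addOrderOf P' = N) :
    P' ∉ (W.localMinimalModel v).goodReductionSubgroup (v.adicCompletionIntegers ℚ) ∧
    W.HasSplitMultiplicativeReductionAt v ∧
    N ∣ ((W.localMinimalModel v).goodReductionSubgroup (v.adicCompletionIntegers ℚ)).index := by
  have h11 := eleven_le_of_prime_of_not_mem hN hNS
  have hqprime : (primesEquiv v : ℕ).Prime := (primesEquiv v).2
  haveI : (W.localMinimalModel v).IsElliptic := W.isElliptic_localMinimalModel v
  have hcard : Nat.card (IsLocalRing.ResidueField (v.adicCompletionIntegers ℚ)) = (primesEquiv v : ℕ) :=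
    WeierstrassCurve.natCard_residueField_adicCompletionIntegers v
  haveI : Finite (IsLocalRing.ResidueField (v.adicCompletionIntegers ℚ)) :=
    Nat.finite_of_card_ne_zero (by rw [hcard]; exact hqprime.ne_zero)
  haveI : PerfectField (IsLocalRing.ResidueField (v.adicCompletionIntegers ℚ)) := PerfectField.ofFinite
  have hP'0 : P' ≠ 0 := by
    intro h0
    rw [h0, addOrderOf_zero] at hP'ord
    exact absurd hP'ord.symm (by omega)
  have hkill' : N • P' = 0 := by
    have e := addOrderOf_nsmul_eq_zero P'
    rwa [hP'ord] at e
  have hkill : (N : ℤ) • P' = 0 := by rw [natCast_zsmul]; exact hkill'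
  have hNk : (N : IsLocalRing.ResidueField (v.adicCompletionIntegers ℚ)) ≠ 0 :=
    natCast_ne_zero_of_card_lt hN (by rw [hcard]; omega)
  -- the reduction is multiplicative (not good by hypothesis, not additive by Step 1)
  have hmult : (W.localMinimalModel v).HasMultiplicativeReduction (v.adicCompletionIntegers ℚ) := by
    rcases hasGoodReduction_or_hasMultiplicativeReduction_or_hasAdditiveReduction
        (v.adicCompletionIntegers ℚ) (W := W.localMinimalModel v) with hg | hm | ha
    · exact absurd hg hbad
    · exact hm
    · exfalso
      haveI := ha
      exact hP'0 (eq_zero_of_hasAdditiveReduction_of_prime_nsmul_eq_zero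
        (v.adicCompletionIntegers ℚ) (W.localMinimalModel v) hN (by omega) hNk hkill')
  haveI := hmult
  -- `P' ∉ E₀(ℚ_v)`
  have hnot : P' ∉ (W.localMinimalModel v).goodReductionSubgroup (v.adicCompletionIntegers ℚ) := by
    intro hmem
    by_cases h2q : 2 * (primesEquiv v : ℕ) + 1 < N
    · have hle := addOrderOf_le_of_mem_goodReductionSubgroup (v.adicCompletionIntegers ℚ)
        (W.localMinimalModel v) hmem (n := N) (by exact_mod_cast hNk) hkill
      rw [hcard, hP'ord] at hle
      omega
    · have h2 : ringChar (IsLocalRing.ResidueField (v.adicCompletionIntegers ℚ)) ≠ 2 := by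
        rw [ringChar_residueField_adicCompletionIntegers]; omega
      have h3 : ringChar (IsLocalRing.ResidueField (v.adicCompletionIntegers ℚ)) ≠ 3 := by
        rw [ringChar_residueField_adicCompletionIntegers]; omega
      have hdvd := prime_dvd_card_sq_sub_one_of_mem_goodReductionSubgroup
        (v.adicCompletionIntegers ℚ) h2 h3 hN hNk (W.localMinimalModel v) hP'0 hkill hmem
      rw [hcard] at hdvd
      have hq1 : 1 ≤ (primesEquiv v : ℕ) := by omega
      have hfac : (primesEquiv v : ℕ) ^ 2 - 1 =
          ((primesEquiv v : ℕ) - 1) * ((primesEquiv v : ℕ) + 1) := by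
        zify [hq1, Nat.one_le_pow 2 (primesEquiv v : ℕ) hq1]
        ring
      rw [hfac] at hdvd
      rcases (Nat.Prime.dvd_mul hN).mp hdvd with h | h
      · have := Nat.le_of_dvd (by omega) h
        omega
      · have := Nat.le_of_dvd (by omega) h
        omega
  obtain ⟨hsplit, hdvd⟩ := hasSplitMultiplicativeReduction_of_not_mem_goodReductionSubgroup
    (v.adicCompletionIntegers ℚ) (W.localMinimalModel v) hN (by omega) hkill' hnot
  exact ⟨hnot, hsplit, hdvd⟩

omit [W.IsElliptic] in
/-- **Transport of a rational point to the minimal model at `v` preserves its order**: the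
`ℚ_v`-point `C • P_{ℚ_v}` of `E.localMinimalModel v = C • E_{ℚ_v}` (`C` the change of variables of
Mathlib's `WeierstrassCurve.minimal`) has the order of `P` (base change and changes of variables
are injective homomorphisms). [folklore] -/
theorem addOrderOf_pointEquiv_map_eq (v : HeightOneSpectrum (𝓞 ℚ)) (P : W.toAffine.Point) :
    addOrderOf (VariableChange.pointEquiv (W.baseChange (v.adicCompletion ℚ))
        ((W.baseChange (v.adicCompletion ℚ)).exists_isMinimal (v.adicCompletionIntegers ℚ)).choose
        (Affine.Point.map (W' := W.toAffine) (S := ℚ) (Algebra.ofId ℚ (v.adicCompletion ℚ)) P)) =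
      addOrderOf P :=
  (AddEquiv.addOrderOf_eq _ _).trans (addOrderOf_injective _
    (Affine.Point.map_injective (W' := W.toAffine) (f := Algebra.ofId ℚ (v.adicCompletion ℚ))) P)

/-- **Mazur's "`ℤ/N ⊄ (E_{/𝔽_q})⁰`" for the rational point of order `N` at every bad place `v`
with `p_v + 1 < N`**, in the language of the completions `ℚ_v = v.adicCompletion ℚ`: the image of
`P` on the minimal model `E.localMinimalModel v = C • E_{ℚ_v}` lies outside `E₀(ℚ_v)`, the
reduction is split multiplicative and `N ∣ c_v`.  This is
`Mazur1977_not_mem_goodReductionSubgroup_of_lt` (`MazurTorsionNodeCountProofs`, stated over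
`ℚ_[q]`) at the place `v`, via `Mazur1977_not_mem_goodReductionSubgroup_of_addOrderOf_eq`.
[cite: Mazur1977, Ch. III §5, Steps 1–3, pp. 158–160] -/
theorem Mazur1977_not_mem_goodReductionSubgroup_at {N : ℕ} (hN : N.Prime)
    (hNS : N ∉ ({2, 3, 5, 7, 13} : Finset ℕ)) {P : W.toAffine.Point} (hP : addOrderOf P = N)
    (v : HeightOneSpectrum (𝓞 ℚ)) (hq : (primesEquiv v : ℕ) + 1 < N)
    (hbad : ¬ W.HasGoodReductionAt v) :
    VariableChange.pointEquiv (W.baseChange (v.adicCompletion ℚ))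
        ((W.baseChange (v.adicCompletion ℚ)).exists_isMinimal (v.adicCompletionIntegers ℚ)).choose
        (Affine.Point.map (W' := W.toAffine) (S := ℚ) (Algebra.ofId ℚ (v.adicCompletion ℚ)) P) ∉
      (W.localMinimalModel v).goodReductionSubgroup (v.adicCompletionIntegers ℚ) ∧
    W.HasSplitMultiplicativeReductionAt v ∧
    N ∣ ((W.localMinimalModel v).goodReductionSubgroup (v.adicCompletionIntegers ℚ)).index :=
  Mazur1977_not_mem_goodReductionSubgroup_of_addOrderOf_eq W hN hNS v hq hbad
    ((addOrderOf_pointEquiv_map_eq W v P).trans hP)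

/-- **Mazur 1977, III.§5, Step 4 at every prime `q` with `q + 1 < N` — the inertia groups above
`q` act trivially on `E[N]`.**  Let `E/ℚ` be an elliptic curve with a rational point of prime
order `N ∉ {2, 3, 5, 7, 13}`, `v` a finite place of `ℚ` with `p_v + 1 < N` (so `p_v ≠ N`), `𝔓` a
prime of `\bar ℤ` above `v` and `τ ∈ I_𝔓 ≤ Gal(ℚ̄/ℚ)`.  Then `τ` fixes every `Q ∈ E(ℚ̄)` with
`N Q = O`.  At a place of good reduction this is Step 4 (i) ("since `E[N]_{/ℤ_q}` is an étale,
finite flat group scheme, `L/K` is unramified over all places of `K` lying over `q`"; tree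
`smul_eq_of_mem_inertia_of_nsmul_eq_zero`, Silverman VII.4.1); at a place of bad reduction it is
Step 4 (iii), the hypothesis "`ℤ/N ⊄ (E_{/𝔽_q})⁰`" of Step 3 being available without modular curves
for `q + 1 < N` (`Mazur1977_not_mem_goodReductionSubgroup_at`).
[cite: Mazur1977, Ch. III §5, Step 4 (i), (iii), p. 160] [cite: SilvermanAEC2009, Prop. VII.4.1] -/
theorem Mazur1977_smul_eq_of_mem_inertia {N : ℕ} (hN : N.Prime)
    (hNS : N ∉ ({2, 3, 5, 7, 13} : Finset ℕ)) {P : W.toAffine.Point} (hP : addOrderOf P = N)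
    (v : HeightOneSpectrum (𝓞 ℚ)) (hq : (primesEquiv v : ℕ) + 1 < N)
    {𝔓 : Ideal (absIntegers (𝓞 ℚ) ℚ)} (h𝔓 : 𝔓 ∈ v.primesAbove)
    {τ : absoluteGaloisGroup ℚ} (hτ : τ ∈ 𝔓.inertia (absoluteGaloisGroup ℚ))
    {Q : geomPoints W} (hQ : N • Q = 0) : τ • Q = Q := by
  have hNv : (N : 𝓞 ℚ) ∉ v.asIdeal := by
    rw [natCast_mem_asIdeal_iff']
    intro h
    have := (Nat.prime_dvd_prime_iff_eq (primesEquiv v).2 hN).mp h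
    omega
  by_cases hgood : W.HasGoodReductionAt v
  · exact W.smul_eq_of_mem_inertia_of_nsmul_eq_zero hgood hNv h𝔓 hτ hQ
  · have hord := (addOrderOf_pointEquiv_map_eq W v P).trans hP
    obtain ⟨hnot, hsplit, -⟩ :=
      Mazur1977_not_mem_goodReductionSubgroup_of_addOrderOf_eq W hN hNS v hq hgood hord
    have hmult : W.HasMultiplicativeReductionAt v := hsplit.toHasMultiplicativeReduction
    have hkill := addOrderOf_nsmul_eq_zero (VariableChange.pointEquiv (W.baseChange (v.adicCompletion ℚ))
        ((W.baseChange (v.adicCompletion ℚ)).exists_isMinimal (v.adicCompletionIntegers ℚ)).choose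
        (Affine.Point.map (W' := W.toAffine) (S := ℚ) (Algebra.ofId ℚ (v.adicCompletion ℚ)) P))
    rw [hord] at hkill
    exact W.smul_eq_of_mem_inertia_of_not_mem_goodReductionSubgroup hmult hN hNv hkill hnot h𝔓 hτ hQ

/-- **Step 4 (iii) from Step 3, at every `q ≠ N`.**  If, as Mazur's Step 3 asserts at every bad
prime, the point `P` lies off `E₀(ℚ_v)` at every place `v` of bad reduction with `p_v ≠ N`, then
the mod-`N` representation is unramified at every `v` with `p_v ≠ N`: every inertia group above
such a `v` fixes `E[N]` pointwise (good `v`: Step 4 (i); bad `v`: the reduction is multiplicative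
by the Kodaira–Néron index argument of Step 1, and Step 4 (iii) applies).  The hypothesis is
proved in the tree for `p_v + 1 < N` (`Mazur1977_not_mem_goodReductionSubgroup_at`); for the
remaining bad primes it is the modular part of Mazur's proof (Step 3, via `X₀(N)_{/ℤ[1/2N]}` and
the Eisenstein quotient).
[cite: Mazur1977, Ch. III §5, Steps 3–4, pp. 159–160] -/
theorem Mazur1977_smul_eq_of_mem_inertia_of_stepThree {N : ℕ} (hN : N.Prime)
    (hNS : N ∉ ({2, 3, 5, 7, 13} : Finset ℕ)) {P : W.toAffine.Point} (hP : addOrderOf P = N)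
    (h3 : ∀ v : HeightOneSpectrum (𝓞 ℚ), ¬ W.HasGoodReductionAt v → (primesEquiv v : ℕ) ≠ N →
      VariableChange.pointEquiv (W.baseChange (v.adicCompletion ℚ))
          ((W.baseChange (v.adicCompletion ℚ)).exists_isMinimal (v.adicCompletionIntegers ℚ)).choose
          (Affine.Point.map (W' := W.toAffine) (S := ℚ) (Algebra.ofId ℚ (v.adicCompletion ℚ)) P) ∉
        (W.localMinimalModel v).goodReductionSubgroup (v.adicCompletionIntegers ℚ))
    (v : HeightOneSpectrum (𝓞 ℚ)) (hvN : (primesEquiv v : ℕ) ≠ N)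
    {𝔓 : Ideal (absIntegers (𝓞 ℚ) ℚ)} (h𝔓 : 𝔓 ∈ v.primesAbove)
    {τ : absoluteGaloisGroup ℚ} (hτ : τ ∈ 𝔓.inertia (absoluteGaloisGroup ℚ))
    {Q : geomPoints W} (hQ : N • Q = 0) : τ • Q = Q := by
  have h11 := eleven_le_of_prime_of_not_mem hN hNS
  have hNv : (N : 𝓞 ℚ) ∉ v.asIdeal := by
    rw [natCast_mem_asIdeal_iff']
    intro h
    exact hvN ((Nat.prime_dvd_prime_iff_eq (primesEquiv v).2 hN).mp h)
  by_cases hgood : W.HasGoodReductionAt v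
  · exact W.smul_eq_of_mem_inertia_of_nsmul_eq_zero hgood hNv h𝔓 hτ hQ
  · have hnot := h3 v hgood hvN
    haveI : (W.localMinimalModel v).IsElliptic := W.isElliptic_localMinimalModel v
    have hcard : Nat.card (IsLocalRing.ResidueField (v.adicCompletionIntegers ℚ)) = (primesEquiv v : ℕ) :=
      WeierstrassCurve.natCard_residueField_adicCompletionIntegers v
    haveI : Finite (IsLocalRing.ResidueField (v.adicCompletionIntegers ℚ)) :=
      Nat.finite_of_card_ne_zero (by rw [hcard]; exact (primesEquiv v).2.ne_zero)
    haveI : PerfectField (IsLocalRing.ResidueField (v.adicCompletionIntegers ℚ)) := PerfectField.ofFinite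
    have hord := (addOrderOf_pointEquiv_map_eq W v P).trans hP
    have hkill := addOrderOf_nsmul_eq_zero (VariableChange.pointEquiv (W.baseChange (v.adicCompletion ℚ))
        ((W.baseChange (v.adicCompletion ℚ)).exists_isMinimal (v.adicCompletionIntegers ℚ)).choose
        (Affine.Point.map (W' := W.toAffine) (S := ℚ) (Algebra.ofId ℚ (v.adicCompletion ℚ)) P))
    rw [hord] at hkill
    obtain ⟨hsplit, -⟩ := hasSplitMultiplicativeReduction_of_not_mem_goodReductionSubgroup
      (v.adicCompletionIntegers ℚ) (W.localMinimalModel v) hN (by omega) hkill hnot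
    have hmult : W.HasMultiplicativeReductionAt v := hsplit.toHasMultiplicativeReduction
    exact W.smul_eq_of_mem_inertia_of_not_mem_goodReductionSubgroup hmult hN hNv hkill hnot h𝔓 hτ hQ

/-- **Representation form**: under the hypotheses of `Mazur1977_smul_eq_of_mem_inertia`,
`ρ̄_{E,N}(τ) = 1` for every `τ` in an inertia group above a place `v` with `p_v + 1 < N` —
"`E[N]` is unramified at `q`". [cite: Mazur1977, Ch. III §5, Step 4 (i), (iii), p. 160] -/
theorem Mazur1977_galoisRepTorsion_eq_one_of_mem_inertia {N : ℕ} (hN : N.Prime)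
    (hNS : N ∉ ({2, 3, 5, 7, 13} : Finset ℕ)) {P : W.toAffine.Point} (hP : addOrderOf P = N)
    (v : HeightOneSpectrum (𝓞 ℚ)) (hq : (primesEquiv v : ℕ) + 1 < N)
    {𝔓 : Ideal (absIntegers (𝓞 ℚ) ℚ)} (h𝔓 : 𝔓 ∈ v.primesAbove)
    {τ : absoluteGaloisGroup ℚ} (hτ : τ ∈ 𝔓.inertia (absoluteGaloisGroup ℚ)) :
    galoisRepTorsion W (N : ℤ) τ = 1 := by
  refine Multiplicative.toAdd.injective (AddEquiv.ext fun Q ↦ Subtype.ext ?_)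
  rw [galoisRepTorsion_apply, AddSubgroup.torsionBy.coe_smul]
  exact Mazur1977_smul_eq_of_mem_inertia W hN hNS hP v hq h𝔓 hτ
    (by
      have h := (Submodule.mem_torsionBy_iff (N : ℤ) Q.1).mp Q.2
      rwa [natCast_zsmul] at h)

end Rat

end Literature.NumberTheory.EllipticCurves

end
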